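import Summits.Ventures.LatticeQCDFlow.Scaling.HubClassStartContentCoverEnum
import Summits.Ventures.LatticeQCDFlow.Scaling.TaggedPerStepDomination

/-!
HONEST FRAMING: exact (Metropolis-corrected) sampling algorithms for lattice gauge theory; figures
of merit are autocorrelation/cost numbers at stated couplings and volumes; no continuum-physics
claim.

# TaggedStartContentCover — CONJECTURE Σ FOR THE TAGGED CHAINS OF AN ADJACENT PAIR (W26'S SETTING VERBATIM): WHEN NO PRESENT ORDINARY CONTENT LIES STRICTLY BETWEEN THE TWO EXTRA
# PARTICLES' PERSISTENCES, THE START-CONTENT DEFICIT OF THE `j`-ATTEMPT LAWS IS AT MOST `X`'S TAG OCCUPATION: `y_j(z) ≤ x_j(z) + x_j(★)` FOR EVERY `j` (lean-2 GEN-40, ours)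

Venture-side (OURS).  Cell `lqcd-flow` (pub-lqcd), unit `pub-lqcd-lean-2-g40`, 2026-08-30.  Chapter Z, file 12.  Setting and hypothesis-equations of W26 `tagged_hub_domination` ∕ Z4: ordinary
composition `NC` (`Σ NC = K`, here `K ≥ 2`), persistence `W > 0`, tagged chains `PX` (tag `a`), `PY` (tag `b`) on `Option S`, `W_b ≤ W_a`, the `j`-attempt hub laws `x_j, y_j` from a common
ordinary hub content `z`.  Under the ADJACENCY-IN-DEPTH hypothesis `hnone` (no present ordinary content `w` with `W_b < W_w < W_a`; contents tied with either tag allowed) the content type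
`Option S` carries a common enumeration sorted for both profiles (Z3 `global_exists_sorted_enum`, `global_sorted_of_key`), and Z11 applies:

* **`tagged_startClass_cover`**: `y_j(z) ≤ x_j(z) + x_j(★)` for every `j`.

With Z8 (`G_j = x_j(★) + (x_j(a)−y_j(a)) − 𝟙{z∉{a,b}}(y_j(z)−x_j(z))⁺`) this gives `G_j ≥ x_j(a) − y_j(a) ≥ 0` and, summed with the weights `w_j = (1−σ)σʲ⁻¹`, the discounted start-content
deficit bound `D ≤ Σ_j w_j·min{x_j(★), (y_j(z)−x_j(z))⁺}` of MEMO-gen40 §4 for such pairs; pairs whose extra particles are separated by other contents need the GLOBAL Σ (toy-true, open).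
Literature grade (cell rule): OWN, plumbing; nothing cited; no new bib keys.
-/

open Finset

namespace Summit.Ventures.LatticeQCDFlow.Scaling

section TaggedCover
variable {S : Type*} [Fintype S] [DecidableEq S]
variable {W : S → ℝ} {acc : S → S → ℝ} {K : ℕ} {NC : S → ℕ} {a b : S} {PX PY : Option S → Option S → ℝ}

/-- **Σ FOR THE TAGGED CHAINS OF AN ADJACENT PAIR WHOSE EXTRA PARTICLES ARE ADJACENT IN DEPTH:** `y_j(z) ≤ x_j(z) + x_j(★)` for every `j`. [ours] -/
theorem tagged_startClass_cover (hW : ∀ v, 0 < W v) (hacc : ∀ h v, acc h v = min 1 (W h / W v)) (hK : 2 ≤ K) (hNC : ∑ v, NC v = K) (hab : W b ≤ W a)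
    (hnone : ∀ w, NC w ≠ 0 → ¬ (W b < W w ∧ W w < W a))
    (hPXoff : ∀ h v, h ≠ v → PX (some h) (some v) = if NC h = 0 then 0 else (NC v : ℝ) / K * acc h v)
    (hPXin : ∀ h, PX (some h) none = if NC h = 0 then 0 else acc h a / K)
    (hPXdiag : ∀ h, PX (some h) (some h) = 1 - (∑ v ∈ univ.erase h, PX (some h) (some v) + PX (some h) none))
    (hPXout : ∀ v, PX none (some v) = (NC v : ℝ) / K * acc a v) (hPXstay : PX none none = 1 - ∑ v, PX none (some v))
    (hPYoff : ∀ h v, h ≠ v → PY (some h) (some v) = if NC h = 0 then 0 else (NC v : ℝ) / K * acc h v)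
    (hPYin : ∀ h, PY (some h) none = if NC h = 0 then 0 else acc h b / K)
    (hPYdiag : ∀ h, PY (some h) (some h) = 1 - (∑ v ∈ univ.erase h, PY (some h) (some v) + PY (some h) none))
    (hPYout : ∀ v, PY none (some v) = (NC v : ℝ) / K * acc b v) (hPYstay : PY none none = 1 - ∑ v, PY none (some v))
    {z : S} (hz : NC z ≠ 0) {x y : ℕ → Option S → ℝ}
    (hx0 : ∀ v, x 0 v = if v = some z then 1 else 0) (hxs : ∀ n v, x (n + 1) v = ∑ h, x n h * PX h v)
    (hy0 : ∀ v, y 0 v = if v = some z then 1 else 0) (hys : ∀ n v, y (n + 1) v = ∑ h, y n h * PY h v) (n : ℕ) :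
    y n (some z) ≤ x n (some z) + x n none := by
  classical
  -- chapter W's data on the content type `Option S` (as in Z4)
  obtain ⟨N', hN'⟩ : ∃ N' : Option S → ℕ, ∀ o, N' o = Option.elim o 1 NC := ⟨_, fun _ => rfl⟩
  obtain ⟨WX', hWX'⟩ : ∃ W' : Option S → ℝ, ∀ o, W' o = Option.elim o (W a) W := ⟨_, fun _ => rfl⟩
  obtain ⟨WY', hWY'⟩ : ∃ W' : Option S → ℝ, ∀ o, W' o = Option.elim o (W b) W := ⟨_, fun _ => rfl⟩
  obtain ⟨accX', haccX'⟩ : ∃ acc' : Option S → Option S → ℝ, ∀ h v, acc' h v = min 1 (WX' h / WX' v) := ⟨_, fun _ _ => rfl⟩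
  obtain ⟨accY', haccY'⟩ : ∃ acc' : Option S → Option S → ℝ, ∀ h v, acc' h v = min 1 (WY' h / WY' v) := ⟨_, fun _ _ => rfl⟩
  obtain ⟨offX, hoffX⟩ : ∃ off : (Option S → ℕ) → Option S → Option S → ℝ, ∀ M h v, off M h v = if M h = 0 then 0 else (M v : ℝ) / K * accX' h v :=
    ⟨_, fun _ _ _ => rfl⟩
  obtain ⟨offY, hoffY⟩ : ∃ off : (Option S → ℕ) → Option S → Option S → ℝ, ∀ M h v, off M h v = if M h = 0 then 0 else (M v : ℝ) / K * accY' h v :=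
    ⟨_, fun _ _ _ => rfl⟩
  obtain ⟨KhX, hKhX⟩ : ∃ Kh : (Option S → ℕ) → Option S → Option S → ℝ, ∀ M h v, Kh M h v = if h = v then 1 - ∑ v' ∈ univ.erase h, offX M h v' else offX M h v :=
    ⟨_, fun _ _ _ => rfl⟩
  obtain ⟨KhY, hKhY⟩ : ∃ Kh : (Option S → ℕ) → Option S → Option S → ℝ, ∀ M h v, Kh M h v = if h = v then 1 - ∑ v' ∈ univ.erase h, offY M h v' else offY M h v :=
    ⟨_, fun _ _ _ => rfl⟩
  have hKXoff : ∀ M h v, h ≠ v → KhX M h v = if M h = 0 then 0 else (M v : ℝ) / K * min 1 (WX' h / WX' v) := fun M h v hhv => by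
    rw [hKhX, if_neg hhv, hoffX, haccX']
  have hKYoff : ∀ M h v, h ≠ v → KhY M h v = if M h = 0 then 0 else (M v : ℝ) / K * min 1 (WY' h / WY' v) := fun M h v hhv => by
    rw [hKhY, if_neg hhv, hoffY, haccY']
  have hKXoff' : ∀ M h v, h ≠ v → KhX M h v = if M h = 0 then 0 else (M v : ℝ) / K * accX' h v := fun M h v hhv => by rw [hKXoff M h v hhv, haccX']
  have hKYoff' : ∀ M h v, h ≠ v → KhY M h v = if M h = 0 then 0 else (M v : ℝ) / K * accY' h v := fun M h v hhv => by rw [hKYoff M h v hhv, haccY']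
  have hKXdiag : ∀ M h, KhX M h h = 1 - ∑ v ∈ univ.erase h, KhX M h v := fun M h => by
    rw [hKhX, if_pos rfl]; congr 1; exact sum_congr rfl fun v hv => by rw [hKhX, if_neg (ne_of_mem_erase hv).symm]
  have hKYdiag : ∀ M h, KhY M h h = 1 - ∑ v ∈ univ.erase h, KhY M h v := fun M h => by
    rw [hKhY, if_pos rfl]; congr 1; exact sum_congr rfl fun v hv => by rw [hKhY, if_neg (ne_of_mem_erase hv).symm]
  have hPX : ∀ h v, PX h v = KhX N' h v := tagged_kernel_eq hacc hPXoff hPXin hPXdiag hPXout hPXstay hN' hWX' hKXoff hKXdiag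
  have hPY : ∀ h v, PY h v = KhY N' h v := tagged_kernel_eq hacc hPYoff hPYin hPYdiag hPYout hPYstay hN' hWY' hKYoff hKYdiag
  let KhnX : ℕ → Option S → Option S → ℝ := fun n =>
    Nat.rec (motive := fun _ => Option S → Option S → ℝ) (fun h v => if h = v then 1 else 0) (fun _ prev h v => ∑ w', prev h w' * KhX N' w' v) n
  let KhnY : ℕ → Option S → Option S → ℝ := fun n =>
    Nat.rec (motive := fun _ => Option S → Option S → ℝ) (fun h v => if h = v then 1 else 0) (fun _ prev h v => ∑ w', prev h w' * KhY N' w' v) n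
  have hKhnX0 : ∀ h v, KhnX 0 h v = if h = v then 1 else 0 := fun _ _ => rfl
  have hKhnXs : ∀ n h v, KhnX (n + 1) h v = ∑ w', KhnX n h w' * KhX N' w' v := fun _ _ _ => rfl
  have hKhnY0 : ∀ h v, KhnY 0 h v = if h = v then 1 else 0 := fun _ _ => rfl
  have hKhnYs : ∀ n h v, KhnY (n + 1) h v = ∑ w', KhnY n h w' * KhY N' w' v := fun _ _ _ => rfl
  have hxrow : ∀ n v, x n v = KhnX n (some z) v := by
    intro n; induction n with
    | zero => intro v; rw [hx0, hKhnX0]; by_cases h : v = some z <;> simp [h, eq_comm]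
    | succ n ih => intro v; rw [hxs, hKhnXs]; exact sum_congr rfl fun h _ => by rw [ih, hPX]
  have hyrow : ∀ n v, y n v = KhnY n (some z) v := by
    intro n; induction n with
    | zero => intro v; rw [hy0, hKhnY0]; by_cases h : v = some z <;> simp [h, eq_comm]
    | succ n ih => intro v; rw [hys, hKhnYs]; exact sum_congr rfl fun h _ => by rw [ih, hPY]
  -- the hypotheses of Z11
  have hWXpos : ∀ o, 0 < WX' o := fun o => by rw [hWX']; rcases o with _ | v <;> simp [hW]
  have hWYpos : ∀ o, 0 < WY' o := fun o => by rw [hWY']; rcases o with _ | v <;> simp [hW]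
  have hagree : ∀ o, o ≠ none → WX' o = WY' o := fun o ho => by
    rcases o with _ | v
    · exact absurd rfl ho
    · rw [hWX', hWY']; rfl
  have hWt : WY' none ≤ WX' none := by rw [hWX', hWY']; exact hab
  have hNK : ∑ o, (N' o : ℝ) = K + 1 := by
    have h1 : ∑ o, (N' o : ℝ) = 1 + ∑ v, (NC v : ℝ) := by rw [Fintype.sum_option]; simp [hN', Option.elim]
    have h2 : ∑ v, (NC v : ℝ) = K := by exact_mod_cast hNC
    rw [h1, h2]; ring
  have hNt : N' none = 1 := by rw [hN']; simp
  have hnone' : ∀ o, N' o ≠ 0 → o ≠ none → ¬ (WY' none < WX' o ∧ WX' o < WX' none) := by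
    intro o ho hon
    rcases o with _ | w
    · exact absurd rfl hon
    · rw [hWX', hWX', hWY']
      have hw : NC w ≠ 0 := by rw [hN'] at ho; exact ho
      exact hnone w hw
  -- a common sorted enumeration
  obtain ⟨m, e, he_inj, he_pres, he_cov, hkey⟩ := global_exists_sorted_enum N' (fun o => WX' o + WY' o) none
  obtain ⟨hsortX, hsortY⟩ := global_sorted_of_key hagree hWt hnone' he_inj he_pres hkey
  have hres := hubClass_startClass_cover_of_enum hWXpos hWYpos hagree hWt haccX' haccY' hK hNK hNt hKXoff' hKXdiag hKYoff' hKYdiag hKhnX0 hKhnXs hKhnY0 hKhnYs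
    he_inj he_pres he_cov hsortX hsortY n (z := some z) (Option.some_ne_none z) (by rw [hN']; exact hz)
  rw [hxrow, hxrow, hyrow]
  exact hres

end TaggedCover

end Summit.Ventures.LatticeQCDFlow.Scaling
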